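import Mathlib
import Summits.Ventures.HodgeRepro2.T5HodgeStar
import Summits.Ventures.HodgeRepro2.T5CoframeInvariance
import Summits.Ventures.HodgeRepro2.T5CoframeAction

/-!
# T5WedgeDeterminant — the Vol-coefficient pairing of two 2-covectors transforms by `det g` under a
coframe change `g ∈ GL₄(ℝ)` (Tier-5 N1 Hodge-side support, seat p6)

Model of `T5CoframeInvariance` / `T5CoframeAction`: a real 2-covector at a point of a complex
surface is its six coefficients in a coframe `(f₁, f₂, f₃, f₄)` of `T^*_sS`, indexed by the six pairs
`pairs = (0,1), (0,2), (0,3), (1,2), (1,3), (2,3)`; a change of coframe by `g ∈ GL₄(ℝ)` acts on them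
by the second compound matrix `compound g = Λ²g` (the `2 × 2` minors), and on the antisymmetric matrix
`B` of a 2-covector by `pull g B = gᵀ B g`, whose coefficient vector is `(Λ²g)ᵀ (coeff B)`
(`T5CoframeAction.coeff_pull`).

Printed input (Voisin, held copy): p0104 l. 7 (the orthonormal coframe and `Vol`); route/T5-N1-hodge-p6.md
§H2.1 («on an orthonormal basis `f₁, …, f₄` with `f₁∧f₂∧f₃∧f₄ = Vol_s`») and §H4 («the sign of
every period `∫_S α ∧ β̄` depends on the orientation of `S`; reversing it changes the sign of
`∫_S f^*w_σ` for every `σ` and leaves (N) («≠ 0») unchanged»).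

What is kernel-checked here: `wedgeR x y` = the coefficient of `f₁∧f₂∧f₃∧f₄` in `x ∧ y` (the real
form of `T5HodgeStar.wedge`) is the symmetric bilinear form with matrix `J`; the explicit 24-term
expansion of a `4 × 4` determinant; the identity `(Λ²g)ᵀ J (Λ²g) = det g · J` (a polynomial identity
in the 16 entries of `g`, checked in all 36 positions) and its transpose; hence
`wedge(Λ²g x, Λ²g y) = det g · wedge(x, y)` and `wedge(coeff (gᵀ B g), coeff (gᵀ B' g)) =
det g · wedge(coeff B, coeff B')`: the Vol-coefficient of a wedge of two 2-covectors is multiplied by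
`det g` under a change of coframe — exactly as `Vol` itself — so it is invariant under `SL₄`,
changes sign under an orientation-reversing change (`det g = −1`), and its vanishing is invariant
under every `g ∈ GL₄(ℝ)`.

Honest scope: pointwise linear algebra on `ℝ⁴`; the passage from the coframe of `T_sS` to the six
coefficients, the integration over `S` and the varieties stay prose. Nothing automorphic.
-/

namespace Summit.Ventures.HodgeRepro2.T5WedgeDeterminant

open Matrix T5CoframeInvariance T5CoframeAction

/-- The real wedge pairing: the coefficient of `f₁∧f₂∧f₃∧f₄` in `x ∧ y` for two real 2-covectors
given by their six coefficients (the real form of `T5HodgeStar.wedge`). -/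
def wedgeR (x y : Fin 6 → ℝ) : ℝ :=
  x 0 * y 5 + x 5 * y 0 - x 1 * y 4 - x 4 * y 1 + x 2 * y 3 + x 3 * y 2

/-- The symmetric `6 × 6` matrix of the wedge pairing. -/
def J : Matrix (Fin 6) (Fin 6) ℝ :=
  !![0, 0, 0, 0, 0, 1; 0, 0, 0, 0, -1, 0; 0, 0, 0, 1, 0, 0; 0, 0, 1, 0, 0, 0; 0, -1, 0, 0, 0, 0;
    1, 0, 0, 0, 0, 0]

/-- `J` is symmetric. -/
theorem J_transpose : Jᵀ = J := by
  ext i j; fin_cases i <;> fin_cases j <;> rfl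

/-- `wedgeR x y = xᵀ J y`. -/
theorem wedgeR_eq_dotProduct (x y : Fin 6 → ℝ) : wedgeR x y = x ⬝ᵥ J.mulVec y := by
  simp [wedgeR, J, dotProduct, mulVec, Fin.sum_univ_six]
  ring

/-- The wedge pairing is symmetric (`2 · 2 = 4` is even). -/
theorem wedgeR_comm (x y : Fin 6 → ℝ) : wedgeR x y = wedgeR y x := by
  simp only [wedgeR]; ring

/-- The real wedge pairing is the complex one of `T5HodgeStar` on real coefficient vectors. -/
theorem wedge_ofReal (x y : Fin 6 → ℝ) :
    T5HodgeStar.wedge (fun i => (x i : ℂ)) (fun i => (y i : ℂ)) = (wedgeR x y : ℂ) := by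
  simp [T5HodgeStar.wedge, wedgeR]

/-- The explicit Leibniz expansion of a `4 × 4` determinant (24 terms). -/
theorem det_fin_four (g : Matrix (Fin 4) (Fin 4) ℝ) :
    g.det = g 0 0 * g 1 1 * g 2 2 * g 3 3 - g 0 0 * g 1 1 * g 2 3 * g 3 2 - g 0 0 * g 1 2 * g 2 1 * g 3 3 + g 0 0 * g 1 2 * g 2 3 * g 3 1 + g 0 0 * g 1 3 * g 2 1 * g 3 2 - g 0 0 * g 1 3 * g 2 2 * g 3 1 - g 0 1 * g 1 0 * g 2 2 * g 3 3 + g 0 1 * g 1 0 * g 2 3 * g 3 2 + g 0 1 * g 1 2 * g 2 0 * g 3 3 - g 0 1 * g 1 2 * g 2 3 * g 3 0 - g 0 1 * g 1 3 * g 2 0 * g 3 2 + g 0 1 * g 1 3 * g 2 2 * g 3 0 + g 0 2 * g 1 0 * g 2 1 * g 3 3 - g 0 2 * g 1 0 * g 2 3 * g 3 1 - g 0 2 * g 1 1 * g 2 0 * g 3 3 + g 0 2 * g 1 1 * g 2 3 * g 3 0 + g 0 2 * g 1 3 * g 2 0 * g 3 1 - g 0 2 * g 1 3 * g 2 1 *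 g 3 0 - g 0 3 * g 1 0 * g 2 1 * g 3 2 + g 0 3 * g 1 0 * g 2 2 * g 3 1 + g 0 3 * g 1 1 * g 2 0 * g 3 2 - g 0 3 * g 1 1 * g 2 2 * g 3 0 - g 0 3 * g 1 2 * g 2 0 * g 3 1 + g 0 3 * g 1 2 * g 2 1 * g 3 0 := by
  rw [Matrix.det_succ_row_zero]
  simp only [Fin.sum_univ_succ, Fin.sum_univ_zero, Matrix.det_fin_three, Matrix.submatrix_apply]
  simp [Fin.succAbove]
  ring

/-- `(Λ²g)ᵀ J (Λ²g) = det g · J`: the wedge pairing of two 2-vectors is multiplied by `det g` under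
`Λ²g` (the pairing lands in `Λ⁴ℝ⁴`, on which `g` acts by `det g`). -/
theorem transpose_compound_mul_J_mul_compound (g : Matrix (Fin 4) (Fin 4) ℝ) :
    (compound g)ᵀ * J * compound g = g.det • J := by
  ext K I
  fin_cases K <;> fin_cases I <;>
    simp [compound, minor, pairs, J, Matrix.mul_apply, Fin.sum_univ_six, det_fin_four] <;> ring

/-- `(Λ²g) J (Λ²g)ᵀ = det g · J` (the same identity for `gᵀ`). -/
theorem compound_mul_J_mul_transpose_compound (g : Matrix (Fin 4) (Fin 4) ℝ) :
    compound g * J * (compound g)ᵀ = g.det • J := by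
  have h := transpose_compound_mul_J_mul_compound gᵀ
  rwa [compound_transpose, transpose_transpose, det_transpose] at h

/-- `wedge(Λ²g x, Λ²g y) = det g · wedge(x, y)` for 2-vectors. -/
theorem wedgeR_mulVec_compound (g : Matrix (Fin 4) (Fin 4) ℝ) (x y : Fin 6 → ℝ) :
    wedgeR ((compound g).mulVec x) ((compound g).mulVec y) = g.det * wedgeR x y := by
  rw [wedgeR_eq_dotProduct, wedgeR_eq_dotProduct, mulVec_mulVec, dotProduct_mulVec,
    ← vecMul_transpose, vecMul_vecMul, ← Matrix.mul_assoc, transpose_compound_mul_J_mul_compound,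
    vecMul_smul, smul_dotProduct, smul_eq_mul, dotProduct_mulVec]

/-- `wedge((Λ²g)ᵀ x, (Λ²g)ᵀ y) = det g · wedge(x, y)` for 2-covectors (the pull-back acts on
coefficients by `(Λ²g)ᵀ`). -/
theorem wedgeR_mulVec_transpose_compound (g : Matrix (Fin 4) (Fin 4) ℝ) (x y : Fin 6 → ℝ) :
    wedgeR ((compound g)ᵀ.mulVec x) ((compound g)ᵀ.mulVec y) = g.det * wedgeR x y := by
  have h := wedgeR_mulVec_compound gᵀ x y
  rwa [compound_transpose, det_transpose] at h

/-- The coefficient form: for antisymmetric `B, B'` (the matrices of two real 2-covectors),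
`wedge(coeff (gᵀ B g), coeff (gᵀ B' g)) = det g · wedge(coeff B, coeff B')` — the Vol-coefficient of
`α ∧ β` transforms by `det g` under the coframe change `g`, exactly as `Vol` does. -/
theorem wedgeR_coeff_pull (g B B' : Matrix (Fin 4) (Fin 4) ℝ) (hB : Bᵀ = -B) (hB' : B'ᵀ = -B') :
    wedgeR (coeff (pull g B)) (coeff (pull g B')) = g.det * wedgeR (coeff B) (coeff B') := by
  rw [coeff_pull g B hB, coeff_pull g B' hB', wedgeR_mulVec_transpose_compound]

/-- Under a unimodular coframe change (`det g = 1`, e.g. a positively oriented orthonormal one) the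
Vol-coefficient of `α ∧ β` is unchanged. -/
theorem wedgeR_coeff_pull_of_det_eq_one (g B B' : Matrix (Fin 4) (Fin 4) ℝ) (hg : g.det = 1)
    (hB : Bᵀ = -B) (hB' : B'ᵀ = -B') :
    wedgeR (coeff (pull g B)) (coeff (pull g B')) = wedgeR (coeff B) (coeff B') := by
  rw [wedgeR_coeff_pull g B B' hB hB', hg, one_mul]

/-- Under an orientation-reversing change (`det g = −1`) every Vol-coefficient changes sign
(§H4: «reversing the orientation changes the sign of every period»). -/
theorem wedgeR_coeff_pull_of_det_eq_neg_one (g B B' : Matrix (Fin 4) (Fin 4) ℝ) (hg : g.det = -1)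
    (hB : Bᵀ = -B) (hB' : B'ᵀ = -B') :
    wedgeR (coeff (pull g B)) (coeff (pull g B')) = -wedgeR (coeff B) (coeff B') := by
  rw [wedgeR_coeff_pull g B B' hB hB', hg, neg_one_mul]

/-- For every invertible coframe change the vanishing of the Vol-coefficient of `α ∧ β` is unchanged
(§H4: «… and leaves (N) («≠ 0») unchanged»). -/
theorem wedgeR_coeff_pull_ne_zero_iff (g B B' : Matrix (Fin 4) (Fin 4) ℝ) (hg : g.det ≠ 0)
    (hB : Bᵀ = -B) (hB' : B'ᵀ = -B') :
    wedgeR (coeff (pull g B)) (coeff (pull g B')) ≠ 0 ↔ wedgeR (coeff B) (coeff B') ≠ 0 := by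
  rw [wedgeR_coeff_pull g B B' hB hB']
  exact (mul_ne_zero_iff_left hg)

/-- An orthogonal change (`gᵀ g = 1`) has `det g = ±1`. -/
theorem det_eq_one_or_neg_one_of_orthogonal (g : Matrix (Fin 4) (Fin 4) ℝ) (hg : gᵀ * g = 1) :
    g.det = 1 ∨ g.det = -1 := by
  have h : g.det * g.det = 1 := by
    have := congrArg Matrix.det hg
    rwa [det_mul, det_transpose, det_one] at this
  have h' : (g.det - 1) * (g.det + 1) = 0 := by linear_combination h
  rcases mul_eq_zero.mp h' with h1 | h1
  · left; linear_combination h1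
  · right; linear_combination h1

/-- For an orthonormal coframe change the Vol-coefficient of `α ∧ β` is unchanged up to the sign
`det g = ±1` of the orientation — the coframe-independence of `γ ∧ δ = (γ, δ) Vol` (§H2.1) on
positively oriented orthonormal coframes, and its sign change on the others. -/
theorem wedgeR_coeff_pull_of_orthogonal (g B B' : Matrix (Fin 4) (Fin 4) ℝ) (hg : gᵀ * g = 1)
    (hB : Bᵀ = -B) (hB' : B'ᵀ = -B') :
    wedgeR (coeff (pull g B)) (coeff (pull g B')) = wedgeR (coeff B) (coeff B') ∨
      wedgeR (coeff (pull g B)) (coeff (pull g B')) = -wedgeR (coeff B) (coeff B') := by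
  rcases det_eq_one_or_neg_one_of_orthogonal g hg with h | h
  · left; exact wedgeR_coeff_pull_of_det_eq_one g B B' h hB hB'
  · right; exact wedgeR_coeff_pull_of_det_eq_neg_one g B B' h hB hB'

end Summit.Ventures.HodgeRepro2.T5WedgeDeterminant
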